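/-
Copyright (c) 2026 the pub-hodgecm-mathlib formalisation cell (harness21).  Prover seat hodgecm-mathlib-K2E2-p06 (g0),
Track B «K2-LIT» ∕ h413 (stmt-HodgeConjecture-24833), line K2_E2 «ThetaExhaustionByRigidity», unit «ORIENT», file #17R:
payment of the socket `K2E2ThetaExhaustionByRigidity.Orient.sig_K2E2OrConjLinearPartnerAtLine` WITH THE FRAME-SIGNATURE BINDERS
`(ι, T, hT, hpos)` (R8 (b) twin #17R, K2/STATUS 2026-09-03T21:44Z) — THE CONJUGATE PARTNER OF `ω_H(μ, a, χ)[ιV]`, ℂ-LINEARLY,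
IN THE GENERIC (C♭) CURRENCY.  2026-09-03.
-/
import Summits.HodgeConjecture.HodgeConjecture.Theorems.H413MirrorAtPinLine                 -- ★ J-c: `MirrorAtPinLine.exists_conjPartner_omegaAtLine_neg` (the pin's conjugate partner)
import Summits.HodgeConjecture.HodgeConjecture.Theorems.H413ConjugatePartnerOfReprIndependence -- ★ `ConjugatePartner.bar_val_eq_setOf`; brings `AdmissibleElement`, `IdeleClassCharacterConjugate`
import Literature.NumberTheory.Automorphic.UnitaryGroupCohomologicalFormsConjRep             -- ★ `ConjVec.repConj`, `repConj_apply`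
import Literature.NumberTheory.Automorphic.Liu2021.Def411WeilCarriersAtLineFrameTransportOfIsometry  -- ★ frame independence `exists_omegaAtLine_equiv_rhoVAtLine_of_isometry`
import Literature.NumberTheory.Automorphic.Liu2021.Def411WeilCarriersAtLineReindex           -- ★ enumeration independence `exists_omegaAtLine_equiv_rhoVAtLine_reindex`
import Literature.NumberTheory.Automorphic.UnitaryGroupFrameHermitian                       -- ★ `cmConjRingHom_apply_eq_of_formCongr_eq_J`
import Literature.NumberTheory.Automorphic.UnitaryGroupFormCongrFinSum                      -- ★ `formCongr_mul_eq`
import Literature.NumberTheory.Automorphic.UnitaryGroupFormTransport                        -- ★ `formCongr_inv_formCongr`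
import Literature.AlgebraicGeometry.ShimuraVarieties.UnitaryBallRealPoints                  -- ★ `signatureMatrix_two`
import HarnessLib

/-!
# K2_E2 road (h413 = stmt-HodgeConjecture-24833), unit «ORIENT», file #17R:
# the conjugate partner `repConj ω_H(μ′, −a, χ̄)[ιV] ≅ ω_H(μ, a, χ)[ιV]`, ℂ-linearly, at a general (C♭) frame

Cell `pub/hodgecm-mathlib` (D-0151), Track B (21-frontier RULING «PUSH BOTH» 2026-09-03, director req621∕req624, chair K2-lead,
dealer K2E2-plan), socket module `Summits/HodgeConjecture/HodgeConjecture/Cruxes/H413/Lines/K2_E2_ThetaExhaustionByRigidity_Orient.lean`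
(planner K2E2-plan (g0), ED. 2 sha16 f86d24634bc7d45a), socket **`sig_K2E2OrConjLinearPartnerAtLineFramed`** (#17R, OR-1R, size M; the
R8 (b) twin of the frozen #17 `sig_K2E2OrConjLinearPartnerAtLine`): #17's statement TOKEN FOR TOKEN with the four frame-signature binders `(ι : L →+* ℂ) (T : GL (Fin 3) ℂ)
(hT : Tᴴ·ι(H)·T = J_{2,1}) (hpos : H definite off the place of ι)` of the closer #18 inserted after `H` (K2E2-p06 R8 flag, K2/STATUS
2026-09-03T21:44Z: the in-tree conjugate partner ★ `MirrorAtPinLine.exists_conjPartner_omegaAtLine_neg` is typed over a rank-3 CM hermitian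
space `V : HodgeCM.HermSpace3`, which needs exactly these binders; the closer #18 carries them, so it instantiates #17R at no cost).

THE STATEMENT.  For `μ` conjugate-symplectic of weight one, `a ∈ (L⁺)ˣ`, `χ ∈ Chi` and a general (C♭) frame `(e₁, dV, g, ιV)` of `U(H)`:
there is a partner `μ′` conjugate-symplectic OF WEIGHT ONE whose CM type is the COMPLEMENT of `Φ_μ`, with the admissibility transfer
`a·(2δ)⁻¹` `Φ_μ`-admissible ⟹ `(−a)·(2δ)⁻¹` `Φ_(μ′)`-admissible, and a BIJECTIVE ℂ-linear intertwiner
`repConj (ω_H(μ′, −a, χ̄)[ιV]) → ω_H(μ, a, χ)[ιV]` (`χ̄ = conj ∘ χ`; ★ `ConjVec.repConj` = the same operators on the conjugate complex structure).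

THE MATHEMATICS ([Liu2021, App. D Lem. D.1 (2)] «the contragredient of `ω(μ, ε, χ)` is `ω(μᶜ, −ε, χ⁻¹)`», for unitary carriers the complex
conjugate; [Liu2021, Rem. 4.4]: `Φ_{μᶜ} = Φ̄_μ`; [Liu2021, Def. 4.12, last sentence]: «`ε` is `μ`-admissible iff `−ε` is `μᶜ`-admissible»).  In tree:
1. package `(H, T)` as `V₀ : HodgeCM.HermSpace3 ⟨L⟩ ι` (★ `cmConjRingHom_apply_eq_of_formCongr_eq_J`, ★ `signatureMatrix_two`) — this is where the
   four binders are consumed;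
2. ★ J-c `MirrorAtPinLine.exists_conjPartner_omegaAtLine_neg` at the PIN FRAME `(e₁⁰, frameD V₀)` of `V₀`: `μ′` of weight one with
   `HasCMType μ′ Φ̄_μ` and a bijective CONJUGATE-linear `U(diag frameD V₀)(𝔸_f)`-equivariant `J : ω(μ,⟨a⟩,χ) → ω(μ′,⟨−a⟩,χ̄)`;
3. clause 2 (complement) is ★ `IsConjugateSymplectic.cmType_eq` + ★ `CMTypeOps.mem_bar_iff`; clause 3 (admissibility) is ★
   `isAdmissibleElement_conj_neg_iff` (`(−a)·δ′ = −(a·δ′)`, `Φ̄ = {τ | τ̄ ∈ Φ}` ★ `ConjugatePartner.bar_val_eq_setOf`);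
4. clause 4: move BOTH carriers from the pin frame to the caller's frame `(e₁, dV, ιV)` by ★ enumeration independence
   (`exists_omegaAtLine_equiv_rhoVAtLine_reindex`) and ★ frame independence (`exists_omegaAtLine_equiv_rhoVAtLine_of_isometry`) along the rational
   isometry `B = g⁻¹ · frameG V₀` (`finAdelicCongr B ∘ ιVE V₀ = ιV`, ★ `coe_finFrameCongr`, ★ `coe_finAdelicCongr_apply`); the sandwich
   `e : w̄ ↦ Φ₂ (Φ₁ (J⁻¹ (Ψ₁⁻¹ (Ψ₂⁻¹ (toConj⁻¹ w̄)))))` is ℂ-LINEAR (two conjugations), bijective, and intertwines `repConj ω_H(μ′,−a,χ̄)[ιV]`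
   (★ `repConj_apply`) with `ω_H(μ,a,χ)[ιV]` — the `U(H)(𝔸_f)`-actions being read through `ιV = finAdelicCongr B ∘ ιVE V₀`.
Pattern: ★ `F0P2mCSharpAntiholOfHol.stubCSharpAntiholOfHol_holds` (steps (1), (4), (6a)–(6d) there), read one level up (carriers instead of
finite components).  No hypothesis is idle except `hT`∕`hpos` beyond packaging (they make `V₀` a CM hermitian space of signature `(2,1)` at `ι`;
the partner exists for any signature in print, but the tree's J is typed over `HermSpace3`).

* §1 two private bookkeeping lemmas (inverting an equivariance);
* §2 **`orConjLinearPartnerAtLineFramed`** — #17R `sig_K2E2OrConjLinearPartnerAtLineFramed` (Orient ED. 2, sha16 f86d24634bc7d45a) TOKEN FOR TOKEN.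
CONSUMER RECIPE (closer #18 `K2E2OrAntiholWitnessOfNeg`): `obtain ⟨μ', hμ', hw', hcm, hadm, e, he⟩ := orConjLinearPartnerAtLineFramed L ι H T hT hpos e₁ dV
hdV hdV0 g hg ιV hιV μ hμ hw a χ`; `(hcm ι).2 hι : ι ∈ Φ_(μ′)`; a hol receiver `P′` of the partner's theta class gives `P′.conj` antihol
(★ `isHolCotangentAt_iff_conj`) with `P′.conj.HasFinComponent (repConj ω_H(μ′,−a,χ̄)[ιV])` (★ `hasFinComponent_conj_repConj`), hence
`P′.conj.HasFinComponent ω_H(μ,a,χ)[ιV]` by ★ #6 `K2E2TrHasFinComponentOfBijective.trHasFinComponentOfBijective … e he`.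

HONEST LABEL: HC_CM is proved only modulo the 7 printed citations (2 remaining named inputs: hLiu418 = stmt-HodgeConjecture-24832,
h413 = stmt-HodgeConjecture-24833) until rung 0 closes; this file is a `--supports stmt-HodgeConjecture-24833` helper (scaffold of the
K2_E2 road, consumed BY NAME by the closer #18) and retires nothing by itself.

## References
* [Liu2021] Y. Liu, *Fourier–Jacobi cycles and arithmetic relative trace formula*, Camb. J. Math. 9 (2021) = arXiv:2102.11518: Def. 4.11
  (l. 2092–2096), Def. 4.12 (last sentence, p. 47), Rem. 4.4, App. D §D.1 Steps 1–3, Lem. D.1 (2) p. 125, Lem. D.1 (3) p. 125 (rank `n ⩾ 3`: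
  the oscillator triple of a carrier is unique — why the partner is CONJUGATE-linear and no ℂ-linear relabel exists).
* [GelbartRogawski1991] S. Gelbart, J. Rogawski, Invent. Math. 105 (1991), §3.1 Prop. 3.1.1 p. 455, Remark p. 457.
* [Clozel1990] L. Clozel, *Motifs et formes automorphes*, in: Automorphic forms, Shimura varieties, and L-functions I (1990), §3.1.
* [PlatonovRapinchuk1994] V. Platonov, A. Rapinchuk, *Algebraic groups and number theory* (1994), §2.3, §5.1.
-/

set_option autoImplicit false
-- the mandated namespace repeats the single-problem summit's segment (`HodgeConjecture.HodgeConjecture`)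
set_option linter.dupNamespace false

noncomputable section

namespace Summit.HodgeConjecture.HodgeConjecture.Cruxes.H413.K2E2OrConjLinearPartnerAtLineFramed

open scoped Matrix ComplexOrder ComplexConjugate
open NumberField NumberField.InfinitePlace IsDedekindDomain MeasureTheory
open Literature.NumberTheory Literature.NumberTheory.Automorphic Literature.NumberTheory.Automorphic.UnitaryGroup
open Literature.NumberTheory.Automorphic.UnitaryGroup.CotangentForms
open Literature.NumberTheory.Automorphic.ConjVec
open Literature.NumberTheory.Automorphic.Liu2021 Literature.NumberTheory.Automorphic.Liu2021.AppendixC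
open Literature.NumberTheory.Automorphic.Liu2021.Def411WeilCarriers
open Literature.NumberTheory.Automorphic.Liu2021.Def411WeilCarriersDoubling
open Literature.NumberTheory.Automorphic.IdeleClassGroup
open Literature.NumberTheory.GelbartRogawski1991 Literature.NumberTheory.GelbartRogawski1991.UnitaryDualPair
open Literature.NumberTheory.GelbartRogawski1991.UnitaryDualPair.WeilCoinv
open Literature.RepresentationTheory Literature.RepresentationTheory.Liu2021
open Literature.NumberTheory.Rogawski1990
open Literature.NumberTheory.ComplexMultiplication.CMTypeOps (bar mem_bar_iff)
open Literature.AlgebraicGeometry.Liu2021 (IsAdmissibleElement isAdmissibleElement_conj_neg_iff)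
open Summit.HodgeConjecture.CorCM
open Summit.HodgeConjecture.CorCM.Transposition
open Summit.HodgeConjecture.CorCM.Transposition.OmegaChiSplitting (sChiD hsChiD)
open HodgeCM.Model HodgeCM.Model.LiuIndex
open HodgeCM.Model.ArchSideTerm (e₁)
open Summit.HodgeConjecture.HodgeConjecture.Cruxes.H413.MirrorAtPinLine (exists_conjPartner_omegaAtLine_neg)
open Summit.HodgeConjecture.HodgeConjecture.Cruxes.H413.ConjugatePartner (bar_val_eq_setOf)

/-! ## §1 Two bookkeeping lemmas on inverting an equivariance (as in ★ `F0P2mCSharpAntiholOfHol`) -/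

/-- if `Ψ` carries `T_A` to `T_B`, then `Ψ⁻¹` carries `T_B` to `T_A` (semilinear equivalences). [folklore] -/
private theorem symm_apply_comm {A B : Type*} [AddCommGroup A] [AddCommGroup B] [Module ℂ A] [Module ℂ B]
    {σ σ' : ℂ →+* ℂ} [RingHomInvPair σ σ'] [RingHomInvPair σ' σ]
    (Ψ : A ≃ₛₗ[σ] B) (TA : A → A) (TB : B → B) (h : ∀ y, Ψ (TA y) = TB (Ψ y)) (x : B) :
    Ψ.symm (TB x) = TA (Ψ.symm x) := by
  apply Ψ.injective
  rw [LinearEquiv.apply_symm_apply, h, LinearEquiv.apply_symm_apply]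

/-- the same for a bijective semilinear MAP, inverted through `LinearEquiv.ofBijective`. [folklore] -/
private theorem ofBijective_symm_apply_comm {A B : Type*} [AddCommGroup A] [AddCommGroup B] [Module ℂ A] [Module ℂ B]
    {σ σ' : ℂ →+* ℂ} [RingHomInvPair σ σ'] [RingHomInvPair σ' σ]
    (J : A →ₛₗ[σ] B) (hJ : Function.Bijective J) (TA : A → A) (TB : B → B) (h : ∀ y, J (TA y) = TB (J y)) (x : B) :
    (LinearEquiv.ofBijective J hJ).symm (TB x) = TA ((LinearEquiv.ofBijective J hJ).symm x) := by
  apply (LinearEquiv.ofBijective J hJ).injective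
  have hx : J ((LinearEquiv.ofBijective J hJ).symm x) = x := (LinearEquiv.ofBijective J hJ).apply_symm_apply x
  rw [LinearEquiv.apply_symm_apply, LinearEquiv.ofBijective_apply, h, hx]

/-! ## §2 The head: #17R `sig_K2E2OrConjLinearPartnerAtLineFramed` token for token -/

set_option synthInstance.maxHeartbeats 400000 in
set_option maxHeartbeats 16000000 in
-- heartbeats: the carriers `rhoAtLine … (isCompatible_chiSplittingLine …)` elaborate the χ-attached splitting telescope on both sides (budget of ★
-- `F0P2mCSharpAntiholOfHol.stubCSharpAntiholOfHol_holds`, same transports).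
/-- **PAYMENT OF `sig_K2E2OrConjLinearPartnerAtLine` IN ITS R8 (b) FORM #17R** (socket #17 of unit «ORIENT» of the K2_E2 road,
`Cruxes/H413/Lines/K2_E2_ThetaExhaustionByRigidity_Orient.lean`, TOKEN FOR TOKEN plus the binders `(ι, T, hT, hpos)` of #18 after `H`).
**The conjugate partner of `ω_H(μ, a, χ)[ιV]`, ℂ-linearly, at a general (C♭) frame.**  For `μ` conjugate-symplectic of weight one, `a ∈ (L⁺)ˣ`,
`χ ∈ Chi`, frame `(e₁, dV, g, ιV)`: a partner `μ′` of weight one with `Φ_(μ′) = ∁Φ_μ`, the admissibility transfer `a ↦ −a`, and a bijective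
ℂ-linear intertwiner `repConj (ω_H(μ′,−a,χ̄)[ιV]) → ω_H(μ,a,χ)[ιV]` — ★ J-c at the pin frame of `V₀ = (H, T)`, ★ reindex∕frame transports on both
sides, §1. [cite: Liu2021, Def. 4.11 (l. 2092–2096); App. D Lem. D.1 (2) (l. 5231); Rem. 4.4; Def. 4.12 (last sentence)]
[cite: GelbartRogawski1991, §3.1 Prop. 3.1.1 p. 455; Remark p. 457] [cite: Clozel1990, §3.1] [cite: PlatonovRapinchuk1994, §2.3] -/
theorem orConjLinearPartnerAtLineFramed :
    ∀ (L : Type) [Field L] [NumberField L] [IsCMField L] (ι : L →+* ℂ) (H : Matrix (Fin 3) (Fin 3) L) (T : GL (Fin 3) ℂ)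
      (hT : (T : Matrix (Fin 3) (Fin 3) ℂ)ᴴ * H.map ι * (T : Matrix (Fin 3) (Fin 3) ℂ) = Literature.Geometry.ComplexHyperbolic.BallModel.J),
      (∀ τ' : L →+* ℂ, InfinitePlace.mk τ' ≠ InfinitePlace.mk ι → (H.map τ').PosDef) →
    ∀ {n' : ℕ} (e₁ : Fin 3 × Fin 1 ≃ Fin n') (dV : Fin 3 → L) (hdV : ∀ i, IsCMField.complexConj L (dV i) = dV i)
      (hdV0 : ∀ i, dV i ≠ 0) (g : GL (Fin 3) L)
      (hg : ((g : Matrix (Fin 3) (Fin 3) L).map (cmConjRingHom L))ᵀ * H * (g : Matrix (Fin 3) (Fin 3) L) = Matrix.diagonal dV)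
      (ιV : finAdelic (↥(maximalRealSubfield L)) L (IsCMField.complexConj L) 3 H →*
          finAdelic (↥(maximalRealSubfield L)) L (IsCMField.complexConj L) 3 (Matrix.diagonal dV)),
        (∀ k, ((ιV k : finAdelic (↥(maximalRealSubfield L)) L (IsCMField.complexConj L) 3 (Matrix.diagonal dV)) :
            GL (Fin 3) (FiniteAdeleRing (𝓞 L) L)) =
          (toFinAdeleGL L 3 g)⁻¹ * (k : GL (Fin 3) (FiniteAdeleRing (𝓞 L) L)) * toFinAdeleGL L 3 g) →
      ∀ (μ : Literature.NumberTheory.Automorphic.IdeleClassGroup L →ₜ* Circle) (hμ : IsConjugateSymplectic L μ), HasWeight L μ 1 →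
        ∀ (a : (↥(maximalRealSubfield L))ˣ) (χ : Chi (↥(maximalRealSubfield L)) L (IsCMField.complexConj L)),
          ∃ (μ' : Literature.NumberTheory.Automorphic.IdeleClassGroup L →ₜ* Circle) (hμ' : IsConjugateSymplectic L μ'),
            HasWeight L μ' 1 ∧ (∀ τ : L →+* ℂ, τ ∈ hμ'.cmType.1 ↔ τ ∉ hμ.cmType.1) ∧
            (IsAdmissibleElement L hμ.cmType.1 (algebraMap (↥(maximalRealSubfield L)) L a * (2 * imagUnit L)⁻¹) →
              IsAdmissibleElement L hμ'.cmType.1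
                (algebraMap (↥(maximalRealSubfield L)) L (↑(-a : (↥(maximalRealSubfield L))ˣ)) * (2 * imagUnit L)⁻¹)) ∧
            ∃ e : Representation.IntertwiningMap
                (ConjVec.repConj
                  (rhoAtLine (↥(maximalRealSubfield L)) L (IsCMField.complexConj L) 3 e₁ (Matrix.diagonal dV)
                    (complexConj_imagUnit L) (imagUnit_ne_zero L) (imagUnit_mul_self L) (realDiagonal_isSymm L dV hdV)
                    (isUnit_det_realDiagonal L dV hdV hdV0) (realDiagonal_map L dV hdV).symm
                    (fun a => isCompatible_chiSplittingLine L e₁ dV hdV hdV0 (toHeckeCharacter L μ')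
                      (isUnitary_toHeckeCharacter L μ') ((isOscillatorChar_toHeckeCharacter_iff μ').mpr hμ')
                      (TW (↥(maximalRealSubfield L)) a) (isSymm_TW (↥(maximalRealSubfield L)) a)
                      (isUnit_det_TW (↥(maximalRealSubfield L)) a) (JW (↥(maximalRealSubfield L)) L a)
                      (JW_eq (↥(maximalRealSubfield L)) L a)) ιV (-a) ⟨(Units.map ((starRingEnd ℂ : ℂ →+* ℂ) : ℂ →* ℂ)).comp χ.1,
                    isAutomorphicOneChar_unitsMap_comp_chi (IsCMField.complexConj L) χ _⟩))
                (rhoAtLine (↥(maximalRealSubfield L)) L (IsCMField.complexConj L) 3 e₁ (Matrix.diagonal dV)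
                  (complexConj_imagUnit L) (imagUnit_ne_zero L) (imagUnit_mul_self L) (realDiagonal_isSymm L dV hdV)
                  (isUnit_det_realDiagonal L dV hdV hdV0) (realDiagonal_map L dV hdV).symm
                  (fun a => isCompatible_chiSplittingLine L e₁ dV hdV hdV0 (toHeckeCharacter L μ)
                    (isUnitary_toHeckeCharacter L μ) ((isOscillatorChar_toHeckeCharacter_iff μ).mpr hμ)
                    (TW (↥(maximalRealSubfield L)) a) (isSymm_TW (↥(maximalRealSubfield L)) a)
                    (isUnit_det_TW (↥(maximalRealSubfield L)) a) (JW (↥(maximalRealSubfield L)) L a)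
                    (JW_eq (↥(maximalRealSubfield L)) L a)) ιV a χ),
              Function.Bijective e := by
  intro L _ _ _ ι H T hT hpos n' e₁' dV hdV hdV0 g hg ιV hιV μ hμ hw a χ
  -- (1) the rank-3 CM hermitian space `V₀ = (H, T)` over the bundled CM field `⟨L⟩` (the four binders are consumed HERE)
  obtain ⟨V₀, hV₀⟩ : ∃ V₀ : HodgeCM.HermSpace3 (⟨L⟩ : HodgeCM.CMField) ι, HodgeCM.HermSpace3.Hm V₀ = H :=
    ⟨⟨H, fun i j => cmConjRingHom_apply_eq_of_formCongr_eq_J L H ι T (formCongr_eq_of_conjTranspose L ι H T hT) i j,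
      ⟨T, by rw [Literature.AlgebraicGeometry.ShimuraVarieties.UnitaryBallUniformisationDatum.signatureMatrix_two]; exact hT⟩, hpos⟩, rfl⟩
  subst hV₀
  -- (2) the pin's conjugate partner `μ′`, `J : ω(μ,⟨a⟩,χ) → ω(μ′,⟨−a⟩,χ̄)` at the pin frame `(e₁⁰, frameD V₀)` (conjugate-linear, bijective, equivariant)
  obtain ⟨μ', hμ', hw', hΦ', J, hJb, hJeq⟩ := exists_conjPartner_omegaAtLine_neg V₀ μ hμ hw hμ.hasCMType_cmType
    ((isOscillatorChar_toHeckeCharacter_iff μ).mpr hμ) a χ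
  have hcm' : hμ'.cmType = bar hμ.cmType := hμ'.cmType_eq hΦ'
  refine ⟨μ', hμ', hw', fun τ => ?_, fun hadm => ?_, ?_⟩
  · -- (3a) the CM type of the partner is the complement
    rw [hcm']
    exact mem_bar_iff _ _
  · -- (3b) `(−a)·δ′ = −(a·δ′)` is admissible for `Φ_(μ′) = Φ̄_μ`
    rw [hcm', bar_val_eq_setOf, Units.val_neg, map_neg, neg_mul]
    exact (isAdmissibleElement_conj_neg_iff _ _).2 hadm
  · -- (4) the intertwiner: transports on both sides, then §1
    -- (4a) enumeration independence at the pin frame `e₁⁰ → e₁`, both carriers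
    obtain ⟨Φ₁, -, hΦ₁⟩ := exists_omegaAtLine_equiv_rhoVAtLine_reindex L e₁ e₁' (frameD V₀) (frameD_real V₀) (frameD_ne V₀)
      (toHeckeCharacter L μ) (isUnitary_toHeckeCharacter L μ) ((isOscillatorChar_toHeckeCharacter_iff μ).mpr hμ) a χ
    obtain ⟨Ψ₁, -, hΨ₁⟩ := exists_omegaAtLine_equiv_rhoVAtLine_reindex L e₁ e₁' (frameD V₀) (frameD_real V₀) (frameD_ne V₀)
      (toHeckeCharacter L μ') (isUnitary_toHeckeCharacter L μ') ((isOscillatorChar_toHeckeCharacter_iff μ').mpr hμ') (-a) ⟨(Units.map ((starRingEnd ℂ : ℂ →+* ℂ) : ℂ →* ℂ)).comp χ.1,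
            isAutomorphicOneChar_unitsMap_comp_chi (IsCMField.complexConj L) χ _⟩
    -- (4b) frame independence along the rational isometry `B := g⁻¹ · frameG V₀` from `diag (frameD V₀)` to `diag dV`, both carriers
    have hg' : formCongr ((IsCMField.complexConj L : L ≃ₐ[↥(maximalRealSubfield L)] L) : L →+* L) g
        (HodgeCM.HermSpace3.Hm V₀) = Matrix.diagonal dV := hg
    have hB : formCongr ((IsCMField.complexConj L : L ≃ₐ[↥(maximalRealSubfield L)] L) : L →+* L) (g⁻¹ * frameG V₀)
        ((1 : L) • Matrix.diagonal dV) = Matrix.diagonal (frameD V₀) := by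
      rw [one_smul, formCongr_mul_eq, ← hg', formCongr_inv_formCongr]
      exact frame_congr V₀
    obtain ⟨Φ₂, hΦ₂⟩ := exists_omegaAtLine_equiv_rhoVAtLine_of_isometry L e₁' (frameD V₀) (frameD_real V₀) (frameD_ne V₀)
      dV hdV hdV0 (g⁻¹ * frameG V₀) hB (toHeckeCharacter L μ) (isUnitary_toHeckeCharacter L μ)
      ((isOscillatorChar_toHeckeCharacter_iff μ).mpr hμ) a χ
    obtain ⟨Ψ₂, hΨ₂⟩ := exists_omegaAtLine_equiv_rhoVAtLine_of_isometry L e₁' (frameD V₀) (frameD_real V₀) (frameD_ne V₀)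
      dV hdV hdV0 (g⁻¹ * frameG V₀) hB (toHeckeCharacter L μ') (isUnitary_toHeckeCharacter L μ')
      ((isOscillatorChar_toHeckeCharacter_iff μ').mpr hμ') (-a) ⟨(Units.map ((starRingEnd ℂ : ℂ →+* ℂ) : ℂ →* ℂ)).comp χ.1,
            isAutomorphicOneChar_unitsMap_comp_chi (IsCMField.complexConj L) χ _⟩
    -- (4c) the two frame transports agree on `U(H)(𝔸_f)`: `B_f (G_f⁻¹ k G_f) B_f⁻¹ = g_f⁻¹ k g_f`
    have hcong : ∀ k : finAdelic (↥(maximalRealSubfield L)) L (IsCMField.complexConj L) 3 (HodgeCM.HermSpace3.Hm V₀),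
        finAdelicCongr (↥(maximalRealSubfield L)) L (IsCMField.complexConj L) (g⁻¹ * frameG V₀) one_ne_zero hB (ιVE V₀ k) =
          ιV k := by
      intro k
      apply Subtype.ext
      rw [coe_finAdelicCongr_apply, hιV k, coe_finFrameCongr, map_mul, map_inv, mul_inv_rev, inv_inv]
      simp only [mul_assoc, mul_inv_cancel_left]
    -- (4d) `J` READ ON THE `isCompatible_chiSplittingLine`-typed carriers over `L` (definitional: `sChiD` unfolds, `⟨L⟩.K = L`)
    have hJc : ∃ Jc : omegaAtLine (↥(maximalRealSubfield L)) L (IsCMField.complexConj L) 3 e₁ (Matrix.diagonal (frameD V₀))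
          (complexConj_imagUnit L) (imagUnit_ne_zero L) (imagUnit_mul_self L) (realDiagonal_isSymm L (frameD V₀) (frameD_real V₀))
          (isUnit_det_realDiagonal L (frameD V₀) (frameD_real V₀) (frameD_ne V₀)) (realDiagonal_map L (frameD V₀) (frameD_real V₀)).symm
          (fun a => isCompatible_chiSplittingLine L e₁ (frameD V₀) (frameD_real V₀) (frameD_ne V₀) (toHeckeCharacter L μ)
            (isUnitary_toHeckeCharacter L μ) ((isOscillatorChar_toHeckeCharacter_iff μ).mpr hμ)
            (TW (↥(maximalRealSubfield L)) a) (isSymm_TW (↥(maximalRealSubfield L)) a) (isUnit_det_TW (↥(maximalRealSubfield L)) a) (JW (↥(maximalRealSubfield L)) L a) (JW_eq (↥(maximalRealSubfield L)) L a)) a χ →ₛₗ[starRingEnd ℂ]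
        omegaAtLine (↥(maximalRealSubfield L)) L (IsCMField.complexConj L) 3 e₁ (Matrix.diagonal (frameD V₀))
          (complexConj_imagUnit L) (imagUnit_ne_zero L) (imagUnit_mul_self L) (realDiagonal_isSymm L (frameD V₀) (frameD_real V₀))
          (isUnit_det_realDiagonal L (frameD V₀) (frameD_real V₀) (frameD_ne V₀)) (realDiagonal_map L (frameD V₀) (frameD_real V₀)).symm
          (fun a => isCompatible_chiSplittingLine L e₁ (frameD V₀) (frameD_real V₀) (frameD_ne V₀) (toHeckeCharacter L μ')
            (isUnitary_toHeckeCharacter L μ') ((isOscillatorChar_toHeckeCharacter_iff μ').mpr hμ')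
            (TW (↥(maximalRealSubfield L)) a) (isSymm_TW (↥(maximalRealSubfield L)) a) (isUnit_det_TW (↥(maximalRealSubfield L)) a) (JW (↥(maximalRealSubfield L)) L a) (JW_eq (↥(maximalRealSubfield L)) L a)) (-a) ⟨(Units.map ((starRingEnd ℂ : ℂ →+* ℂ) : ℂ →* ℂ)).comp χ.1,
            isAutomorphicOneChar_unitsMap_comp_chi (IsCMField.complexConj L) χ _⟩,
        Function.Bijective Jc ∧
        ∀ (k : finAdelic (↥(maximalRealSubfield L)) L (IsCMField.complexConj L) 3 (Matrix.diagonal (frameD V₀)))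
          (y : omegaAtLine (↥(maximalRealSubfield L)) L (IsCMField.complexConj L) 3 e₁ (Matrix.diagonal (frameD V₀))
          (complexConj_imagUnit L) (imagUnit_ne_zero L) (imagUnit_mul_self L) (realDiagonal_isSymm L (frameD V₀) (frameD_real V₀))
          (isUnit_det_realDiagonal L (frameD V₀) (frameD_real V₀) (frameD_ne V₀)) (realDiagonal_map L (frameD V₀) (frameD_real V₀)).symm
          (fun a => isCompatible_chiSplittingLine L e₁ (frameD V₀) (frameD_real V₀) (frameD_ne V₀) (toHeckeCharacter L μ)
            (isUnitary_toHeckeCharacter L μ) ((isOscillatorChar_toHeckeCharacter_iff μ).mpr hμ)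
            (TW (↥(maximalRealSubfield L)) a) (isSymm_TW (↥(maximalRealSubfield L)) a) (isUnit_det_TW (↥(maximalRealSubfield L)) a) (JW (↥(maximalRealSubfield L)) L a) (JW_eq (↥(maximalRealSubfield L)) L a)) a χ),
          Jc (rhoVAtLine (↥(maximalRealSubfield L)) L (IsCMField.complexConj L) 3 e₁ (Matrix.diagonal (frameD V₀))
          (complexConj_imagUnit L) (imagUnit_ne_zero L) (imagUnit_mul_self L) (realDiagonal_isSymm L (frameD V₀) (frameD_real V₀))
          (isUnit_det_realDiagonal L (frameD V₀) (frameD_real V₀) (frameD_ne V₀)) (realDiagonal_map L (frameD V₀) (frameD_real V₀)).symm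
          (fun a => isCompatible_chiSplittingLine L e₁ (frameD V₀) (frameD_real V₀) (frameD_ne V₀) (toHeckeCharacter L μ)
            (isUnitary_toHeckeCharacter L μ) ((isOscillatorChar_toHeckeCharacter_iff μ).mpr hμ)
            (TW (↥(maximalRealSubfield L)) a) (isSymm_TW (↥(maximalRealSubfield L)) a) (isUnit_det_TW (↥(maximalRealSubfield L)) a) (JW (↥(maximalRealSubfield L)) L a) (JW_eq (↥(maximalRealSubfield L)) L a)) a χ k y) =
            rhoVAtLine (↥(maximalRealSubfield L)) L (IsCMField.complexConj L) 3 e₁ (Matrix.diagonal (frameD V₀))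
          (complexConj_imagUnit L) (imagUnit_ne_zero L) (imagUnit_mul_self L) (realDiagonal_isSymm L (frameD V₀) (frameD_real V₀))
          (isUnit_det_realDiagonal L (frameD V₀) (frameD_real V₀) (frameD_ne V₀)) (realDiagonal_map L (frameD V₀) (frameD_real V₀)).symm
          (fun a => isCompatible_chiSplittingLine L e₁ (frameD V₀) (frameD_real V₀) (frameD_ne V₀) (toHeckeCharacter L μ')
            (isUnitary_toHeckeCharacter L μ') ((isOscillatorChar_toHeckeCharacter_iff μ').mpr hμ')
            (TW (↥(maximalRealSubfield L)) a) (isSymm_TW (↥(maximalRealSubfield L)) a) (isUnit_det_TW (↥(maximalRealSubfield L)) a) (JW (↥(maximalRealSubfield L)) L a) (JW_eq (↥(maximalRealSubfield L)) L a)) (-a) ⟨(Units.map ((starRingEnd ℂ : ℂ →+* ℂ) : ℂ →* ℂ)).comp χ.1,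
            isAutomorphicOneChar_unitsMap_comp_chi (IsCMField.complexConj L) χ _⟩ k (Jc y) :=
      ⟨J, hJb, hJeq⟩
    obtain ⟨Jc, hJcb, hJc⟩ := hJc
    clear hJeq hJb J
    -- (4e) the ℂ-linear map `e : w̄ ↦ Φ₂ (Φ₁ (J⁻¹ (Ψ₁⁻¹ (Ψ₂⁻¹ (toConj⁻¹ w̄)))))` (two conjugations: `toConj⁻¹` and `J⁻¹`)
    let θ := (LinearEquiv.ofBijective Jc hJcb).symm
    have hθ : ∀ z, θ z = (LinearEquiv.ofBijective Jc hJcb).symm z := fun z => rfl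
    -- (`∘ₗ` is linear-only notation; the two conjugate-linear links are composed with `LinearMap.comp`)
    let φ : ConjVec _ →ₗ[ℂ] _ := Φ₂.toLinearMap ∘ₗ Φ₁.toLinearMap ∘ₗ
      (θ.toLinearMap.comp (Ψ₁.symm.toLinearMap.comp (Ψ₂.symm.toLinearMap.comp (toConj (V := _)).symm.toLinearMap)))
    have hφ : ∀ w, φ w = Φ₂ (Φ₁ (θ (Ψ₁.symm (Ψ₂.symm ((toConj (V := _)).symm w))))) := fun w => rfl
    refine ⟨LinearMap.intertwiningMap_of_isIntertwiningMap _ _ φ (fun k w => ?_), ?_, ?_⟩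
    · -- (4f) equivariance through `ιV` (`hcong`): push `k` through the six maps
      rw [hφ, hφ, hθ, hθ, repConj_apply, LinearEquiv.symm_apply_apply, rhoAtLine_apply, rhoAtLine_apply, ← hcong k,
        symm_apply_comm Ψ₂ _ _ (hΨ₂ (ιVE V₀ k)) _, symm_apply_comm Ψ₁ _ _ (hΨ₁ (ιVE V₀ k)) _,
        ofBijective_symm_apply_comm Jc hJcb _ _ (hJc (ιVE V₀ k)) _, hΦ₁, hΦ₂]
    · -- injectivity
      intro x x' hxx'
      have h1 : φ x = φ x' := hxx'
      rw [hφ, hφ] at h1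
      exact (toConj (V := _)).symm.injective (Ψ₂.symm.injective (Ψ₁.symm.injective (θ.injective
        (Φ₁.injective (Φ₂.injective h1)))))
    · -- surjectivity: the explicit preimage `toConj (Ψ₂ (Ψ₁ (J (Φ₁⁻¹ (Φ₂⁻¹ z)))))`
      intro z
      refine ⟨toConj (V := _) (Ψ₂ (Ψ₁ (θ.symm (Φ₁.symm (Φ₂.symm z))))), ?_⟩
      show φ _ = z
      rw [hφ, LinearEquiv.symm_apply_apply, LinearEquiv.symm_apply_apply, LinearEquiv.symm_apply_apply,
        LinearEquiv.apply_symm_apply, LinearEquiv.apply_symm_apply, LinearEquiv.apply_symm_apply]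

end Summit.HodgeConjecture.HodgeConjecture.Cruxes.H413.K2E2OrConjLinearPartnerAtLineFramed

end
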